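import Summits.ResolutionOfSingularities.ResolutionOfSingularities.Theorems.StallVertexRigidClasses
import HarnessLib

/-!
# MaxContactCutStallVertex — decomp-res node «StallVertex» (lens-5 g20 rev 2), tree file 9/9 of the node

Content VERBATIM from the decomp-res lens-5 g20 file
`HOME/decomp-res-lens-5/g20/parts/StallVertex-g20-rev2-d6168cb0.lean` (1724 l; rev 2, which SUPERSEDES
the pins 0349e14d (869 l) and rev 1 d60a69dd with all earlier statements byte-identical; HOME =
run/shared/lean/pub/decomp-res).  The rev-0 sections §1/§2/§3/§4
are ALREADY in the tree from pin 0349e14d as `StallVertexForms` / `StallVertexKernels` / `StallVertexWalk` /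
`StallVertexClasses`; this file carries ONLY
declarations NEW in rev 1 / rev 2.  Critic: CRITIC-LEDGER rows 142 (CLEARED 20:41:19Z: the stall vertex law), 142a
(21:01:24Z: rev 1 stall rigidity), 142b
(21:17:44Z: rev 2 contact-line law; ONE located-residual aside = `StallVertex.NoLineFreeRigidSkewStalledTailsDeep`,
the sharpest exact form, chain
skew ↔ vertexBound ↔ rigid ↔ lineFree hypothesis-free, superseding `CoefficientCut.NoSkewJointTailsDeep`).
Landed by decomp-res writer g7.  Every file of the
node is in the Theses cone (the lens imports the in-cone `DifferentialShade`), so the residual is booked on the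
route by RE-LOCATING the existing aside 28122
`CFNoSkewJointTailsDeep` (EXACTLY ⟺ it) — one aside, not two.

Wiring (Theses cone, BY NAME on the MaxContactCut aside `DefectWalksDeep` 31770), VERBATIM from rev-2 §4: `closes`
/ `defectWalksDeep_iff` (⟺ NoFreePointTailsDeep ∧
CoefficientCut.NoPlanarJointTailsDeep ∧ NoVertexBoundSkewStalledTailsDeep), `closes_lineFree` /
`defectWalksDeep_iff_lineFree` (… ∧ NoLineFreeRigidSkewStalledTailsDeep),
`defectWalksDeep_iff_split` (… ∧ NoMonomialSkewStalledTailsDeep ∧ NoPositiveOnConeSkewStalledTailsDeep).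
Imports `StallVertexRigidClasses`.  Supports 31770.

[WRITER NOTE (decomp-res writer g7): file split only; namespace, opens, section variables and every declaration
exactly as in the lens (global `set_option` dropped; the lens's `set_option maxHeartbeats … in` on `stall_rigid` kept).]

(Sources: KawanoueMatsuki2016 Prop. 4 (2), §4.1; Hauser2010; HauserPerlega2024; Moh1987; CossartPiltant2008;
Giraud1975; Hironaka1964; ZariskiSamuelII Ch. VIII §2.)
-/

noncomputable section

open MvPolynomial Finset
open Literature.AlgebraicGeometry.Resolution
open Literature.AlgebraicGeometry.Resolution.Hauser2010
open Literature.AlgebraicGeometry.Resolution.HauserPerlega2024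
open Literature.Barriers.ResolutionOfSingularities
open Literature.AlgebraicGeometry.Resolution.PointBlowup
open Summit.ResolutionOfSingularities.ResolutionOfSingularities.Theses
open Summit.ResolutionOfSingularities.ResolutionOfSingularities.Theorems.TightDefectClasses
open Summit.ResolutionOfSingularities.ResolutionOfSingularities.Theorems.ProximityCut
open Summit.ResolutionOfSingularities.ResolutionOfSingularities.Theorems.ExitLaw
open Summit.ResolutionOfSingularities.ResolutionOfSingularities.Theorems.DifferentialShade

namespace Summit.ResolutionOfSingularities.ResolutionOfSingularities.Theorems.StallVertex

section Classes

/-- **`closes` BY NAME**: the target aside `MaxContactCut.DefectWalksDeep` from the free-point half (tree, DECIDED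
modulo nothing: `NoFreePointTailsDeep` is itself a tree class of the ProximityCut node), the planar window (PORT,
g19/tree `CoefficientCut.NoPlanarJointTailsDeep`) and THE located residual of this generation. [folklore] -/
theorem closes (hA : NoFreePointTailsDeep) (hP : CoefficientCut.NoPlanarJointTailsDeep)
    (hV : NoVertexBoundSkewStalledTailsDeep) : MaxContactCut.DefectWalksDeep :=
  defectWalksDeep_iff_joint'.mpr ⟨hA, joint_iff_planar_vertexBound.mpr ⟨hP, hV⟩⟩

/-- **EXACT cut of the target.** [folklore] -/
theorem defectWalksDeep_iff :
    MaxContactCut.DefectWalksDeep ↔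
      NoFreePointTailsDeep ∧ CoefficientCut.NoPlanarJointTailsDeep ∧ NoVertexBoundSkewStalledTailsDeep := by
  rw [defectWalksDeep_iff_joint', joint_iff_planar_vertexBound]

/-- **THE NODE, rev 2 (BY NAME):** free-point half [tree] + planar window [PORT] + the LINE-FREE rigid residual ⟹ the
host target (the contact-line cell is decided in kernel, `noContactLineSkewTailsDeep_holds`). [folklore] -/
theorem closes_lineFree (hA : NoFreePointTailsDeep) (hP : CoefficientCut.NoPlanarJointTailsDeep)
    (hL : NoLineFreeRigidSkewStalledTailsDeep) : MaxContactCut.DefectWalksDeep :=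
  closes hA hP (vertexBound_iff_rigid.mpr (rigid_iff_lineFree.mpr hL))

/-- **EXACT form of the rev-2 node.** [folklore] -/
theorem defectWalksDeep_iff_lineFree : MaxContactCut.DefectWalksDeep ↔
    NoFreePointTailsDeep ∧ CoefficientCut.NoPlanarJointTailsDeep ∧ NoLineFreeRigidSkewStalledTailsDeep := by
  rw [defectWalksDeep_iff, vertexBound_iff_rigid, rigid_iff_lineFree]

/-- **The full EXACT cut with the split opened:** target `↔` free-point half `∧` planar window `∧` monomial leaf `∧`
positive on-cone leaf. [folklore] -/
theorem defectWalksDeep_iff_split :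
    MaxContactCut.DefectWalksDeep ↔
      NoFreePointTailsDeep ∧ CoefficientCut.NoPlanarJointTailsDeep ∧
        NoMonomialSkewStalledTailsDeep ∧ NoPositiveOnConeSkewStalledTailsDeep := by
  rw [defectWalksDeep_iff, vertexBound_iff_monomial_onCone]

end Classes

end Summit.ResolutionOfSingularities.ResolutionOfSingularities.Theorems.StallVertex
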